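import Summits.MatrixMultiplication.MatrixMultiplication.Theorems.AbelianSTPPCensusTAStatDefs

/-!
# T_A static certificate: two data-free sharpenings for the range past `6190` (definitions + abstract soundness)

Cell mm-stpp (rung F-M1), threshold T_A = `τ = 2.371`.  The static t*-indexed checker (`AbelianSTPPCensusTAStatDefs.lean`, ranges `TAStat`/`TAStatB`/
`TAStatC`, kernel `≤ 6190`) reads the companions of the maximal-volume member `l` through ONE density entry.  Its exact twin first fails at order
`6199`; two free sharpenings carry the same table family to `≈ 6379` (seat twins HOME/mm-stpp-theory/tastat2/tastat3.py, tastat4.py; kit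
j291146 / j291218 / j291261; design HOME/mm-stpp-theory/TA-RANGE-D-RECIPE.md).  This file holds their DATA-FREE parts, so that a later range can
import them:
* `tiOK V t` — the integer test «every sorted shape `(a ≤ b ≤ c)` of volume `≤ V` has `a·b < t`» (`a·b·b ≤ a·b·c ≤ V`), replacing the real bound
  `t*³ ≤ V²` as the escape of the bucket walk; `tiOK_sound`.
* `cover2` — the exact per-order check of a maximal member `l` TOGETHER WITH an explicit second member `m` (the member realising `t*`, when the bucket
  lies above `l`'s own): gains `g_l + g_m` explicit, the companions' caps (U11 `2Σp + d ≤ 3M`, U14 `Σp + 3V ≤ 3M`, E3 `Σp ≤ ⌊V²/M⌋ + 3M − 4V` for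
  `M < 2V`, Grynkiewicz form B at `t′`) each reduced by `m`'s own mass, the rest bounded by the same density entry; `cover2_sound` is its soundness
  with the row facts as hypotheses (exactly the facts `TAStatC.sum_gain_le` already derives: `hsum1`, `hsum2`, `hcap`, `hcore`, `hsumg`).
WHAT THIS IS NOT: no statement about STPP families, orders or `ω` — two Bool checks and their arithmetic meaning; nothing here is specific to a range.
-/

set_option linter.dupNamespace false
set_option autoImplicit false

namespace Summit.MatrixMultiplication.MatrixMultiplication.Theorems.TAStat2M

open TAStat (Entry)
open ShapeCert (D)

/-! ## The integer `t*`-bound -/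

/-- `tiOK V t`: for every `b < 80`, `min(b, ⌊V/b²⌋)·b < t` — i.e. every sorted shape `(a ≤ b ≤ c)` with `a·b·b ≤ V` has `a·b < t`
(valid reading for `V < 6400`, where `b·b ≤ V` forces `b < 80`). [original] -/
def tiOK (V t : ℕ) : Bool := (List.range 80).all fun b => Nat.blt (min b (V / (b * b)) * b) t

/-- Soundness of `tiOK`: `a ≤ b`, `1 ≤ a`, `a·b·b ≤ V < 6400` and `tiOK V t` give `a·b < t`. [original] -/
theorem tiOK_sound {V t a b : ℕ} (h : tiOK V t = true) (ha : 1 ≤ a) (hab : a ≤ b) (hV : a * b * b ≤ V) (hV80 : V < 6400) :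
    a * b < t := by
  have hb1 : 1 ≤ b := le_trans ha hab
  have hbb : b * b ≤ V := le_trans (by
    calc b * b = 1 * b * b := by ring
      _ ≤ a * b * b := Nat.mul_le_mul_right _ (Nat.mul_le_mul_right _ ha)) hV
  have hb80 : b < 80 := by
    by_contra hc; push Not at hc
    have : 80 * 80 ≤ b * b := Nat.mul_le_mul hc hc
    omega
  simp only [tiOK, List.all_eq_true, List.mem_range, Nat.blt_eq] at h
  have hb := h b hb80
  have hbpos : 0 < b * b := Nat.mul_pos (by omega) (by omega)
  have hadiv : a ≤ V / (b * b) := (Nat.le_div_iff_mul_le hbpos).2 (by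
    calc a * (b * b) = a * b * b := by ring
      _ ≤ V := hV)
  have hamin : a ≤ min b (V / (b * b)) := le_min hab hadiv
  calc a * b ≤ min b (V / (b * b)) * b := Nat.mul_le_mul_right _ hamin
    _ < t := hb

/-! ## The two-member cover (exact per order) -/

/-- U11-G test at order `M` with two explicit members: `(g+g_m)·wW + gW·(t·M + (2t²−1)) ≤ 10⁶·M·wW + gW·((t·p − V) + (t·p_m − V_m))`. [original] -/
def c2W (g p V t gm pm Vm M : ℕ) (e : Entry) : Bool :=
  Nat.ble ((g + gm) * e.2.2.2 + e.2.2.1 * (t * M + (2 * t * t - 1))) (D * M * e.2.2.2 + e.2.2.1 * ((t * p - V) + (t * pm - Vm)))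

/-- vM test through the U11 cap with two explicit members: `2(g+g_m)·pP + gP·3M ≤ 2·10⁶·M·pP + gP·(d + 2p_m)`. [original] -/
def c2A (g d gm pm M : ℕ) (e : Entry) : Bool :=
  Nat.ble (2 * (g + gm) * e.2.1 + e.1 * (3 * M)) (2 * D * M * e.2.1 + e.1 * (d + 2 * pm))

/-- vM test through the U14 cap with two explicit members: `(g+g_m)·pP + gP·3M ≤ 10⁶·M·pP + gP·(3V + p_m)`. [original] -/
def c2B (g V gm pm M : ℕ) (e : Entry) : Bool :=
  Nat.ble ((g + gm) * e.2.1 + e.1 * (3 * M)) (D * M * e.2.1 + e.1 * (3 * V + pm))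

/-- vM test through the E3 cap (order `M < 2V`) with two explicit members: `(g+g_m)·pP + gP·(⌊V²/M⌋ + 3M) ≤ 10⁶·M·pP + gP·(4V + p_m)`. [original] -/
def c2E (g V gm pm M : ℕ) (e : Entry) : Bool :=
  Nat.blt M (2 * V) && Nat.ble ((g + gm) * e.2.1 + e.1 * (V * V / M + 3 * M)) (D * M * e.2.1 + e.1 * (4 * V + pm))

/-- **Two-member cover.**  The maximal member `l` (gain `g`, pair-product sum `p`, volume `V`, excess `d = 2p − (a+b+c)`) together with an explicit
second member `m` (gain `gm`, pair-product sum `pm`, volume `Vm`) at budget parameter `t` passes, at EVERY order `M ∈ [L, H]`, one of the four tests;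
guards `3 ≤ t`, `V < t·p`, `V_m ≤ t·p_m` (both explicit weights genuine). [original] -/
def cover2 (g p V d t L H gm pm Vm : ℕ) (e : Entry) : Bool :=
  Nat.ble 3 t && Nat.blt V (t * p) && Nat.ble Vm (t * pm) &&
    (List.range (H + 1 - L)).all fun k =>
      c2W g p V t gm pm Vm (L + k) e || c2A g d gm pm (L + k) e || c2B g V gm pm (L + k) e || c2E g V gm pm (L + k) e

/-- **Soundness of the two-member cover.**  At an order `M ∈ [L, H]`, with `GR` = the remaining members' total gain, `R` = their total
pair-product sum and `A` = their total U11-G weight `Σ (t·p_q − V_q)`: the density bounds `GR·pP ≤ gP·R`, `GR·wW ≤ gW·A`, the caps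
`2(p_m + R) + d ≤ 3M` (U11), `p_m + R + 3V ≤ 3M` (U14), `M < 2V → p_m + R ≤ (⌊V²/M⌋ + 3M) − 4V` (E3) and the Grynkiewicz budget
`(t·p − V) + (t·p_m − V_m) + A ≤ t·M + (2t² − 1)` give `g + g_m + GR ≤ 10⁶·M`. [original] -/
theorem cover2_sound {g p V d t L H gm pm Vm : ℕ} {e : Entry} (hc : cover2 g p V d t L H gm pm Vm e = true)
    {M GR R A : ℕ} (hLM : L ≤ M) (hMH : M ≤ H) (hpP : 1 ≤ e.2.1) (hwW : 1 ≤ e.2.2.2) (hpm : 1 ≤ pm)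
    (hGP : GR * e.2.1 ≤ e.1 * R) (hGW : GR * e.2.2.2 ≤ e.2.2.1 * A)
    (hA : 2 * (pm + R) + d ≤ 3 * M) (hB : pm + R + 3 * V ≤ 3 * M)
    (hE : M < 2 * V → pm + R ≤ (V * V / M + 3 * M) - 4 * V)
    (hW : 3 ≤ t → V < t * p → Vm ≤ t * pm → (t * p - V) + (t * pm - Vm) + A ≤ t * M + (2 * t * t - 1)) :
    g + gm + GR ≤ D * M := by
  simp only [cover2, Bool.and_eq_true, Nat.ble_eq, Nat.blt_eq, List.all_eq_true, List.mem_range, Bool.or_eq_true] at hc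
  obtain ⟨⟨⟨ht3, hVtp⟩, hVm⟩, hall⟩ := hc
  have hk := hall (M - L) (by omega)
  rw [show L + (M - L) = M by omega] at hk
  rcases hk with ((hw | ha) | hb) | hee
  · -- U11-G
    simp only [c2W, Nat.ble_eq] at hw
    have h1 : e.2.2.1 * ((t * p - V) + (t * pm - Vm)) + e.2.2.1 * A ≤ e.2.2.1 * (t * M + (2 * t * t - 1)) := by
      rw [← Nat.mul_add]; exact Nat.mul_le_mul_left _ (hW ht3 hVtp hVm)
    have key : (g + gm + GR) * e.2.2.2 ≤ D * M * e.2.2.2 := by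
      rw [Nat.add_mul]
      omega
    exact Nat.le_of_mul_le_mul_right key hwW
  · -- U11 cap
    simp only [c2A, Nat.ble_eq] at ha
    have h1 : e.1 * (d + 2 * pm) + e.1 * (2 * R) ≤ e.1 * (3 * M) := by
      rw [← Nat.mul_add]; exact Nat.mul_le_mul_left _ (by omega)
    have h2 : 2 * (GR * e.2.1) ≤ e.1 * (2 * R) := by
      calc 2 * (GR * e.2.1) ≤ 2 * (e.1 * R) := Nat.mul_le_mul_left _ hGP
        _ = e.1 * (2 * R) := by ring
    have key : (g + gm + GR) * e.2.1 ≤ D * M * e.2.1 := by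
      have e1 : 2 * (g + gm) * e.2.1 = 2 * ((g + gm) * e.2.1) := by ring
      have e2 : 2 * D * M * e.2.1 = 2 * (D * M * e.2.1) := by ring
      rw [e1, e2] at ha
      rw [Nat.add_mul]
      omega
    exact Nat.le_of_mul_le_mul_right key hpP
  · -- U14 cap
    simp only [c2B, Nat.ble_eq] at hb
    have h1 : e.1 * (3 * V + pm) + e.1 * R ≤ e.1 * (3 * M) := by
      rw [← Nat.mul_add]; exact Nat.mul_le_mul_left _ (by omega)
    have key : (g + gm + GR) * e.2.1 ≤ D * M * e.2.1 := by
      rw [Nat.add_mul]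
      omega
    exact Nat.le_of_mul_le_mul_right key hpP
  · -- E3 cap
    simp only [c2E, Bool.and_eq_true, Nat.blt_eq, Nat.ble_eq] at hee
    obtain ⟨h2V, he⟩ := hee
    have hcap := hE h2V
    generalize hC : V * V / M + 3 * M = C at he hcap
    have hC4 : 4 * V + pm + R ≤ C := by omega
    have h1 : e.1 * (4 * V + pm) + e.1 * R ≤ e.1 * C := by
      rw [← Nat.mul_add]; exact Nat.mul_le_mul_left _ hC4
    have key : (g + gm + GR) * e.2.1 ≤ D * M * e.2.1 := by
      rw [Nat.add_mul]
      omega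
    exact Nat.le_of_mul_le_mul_right key hpP

/-! ## Assembly: from the row facts of `sum_gain_le` to the two-member bound -/

/-- **Assembly of the two-member branch.**  In the setting of `TAStatC.sum_gain_le` (maximal member `l` with gain `g`, pair-product sum `p`, volume `V`,
excess `d`; every member `q` dominated by the entry `e` at parameter `t`: `g_q·pP ≤ gP·p_q`, `g_q·wW ≤ gW·(t·p_q − V_q)`; the companions' rows
`2·Σ_{q≠l} p_q + d ≤ 3M`, `Σ_{q≠l} p_q + 3V ≤ 3M`, `M < 2V → Σ_{q≠l} p_q ≤ (⌊V²/M⌋ + 3M) − 4V`, and the Grynkiewicz budget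
`Σ_{q≠l} (t·p_q − V_q) + (t·p − V) ≤ t·M + (2t² − 1)`), a second member `m ≠ l` passing `cover2` gives `g + Σ_{q≠l} g_q ≤ 10⁶·M`. [original] -/
theorem two_member_assembly {N : ℕ} {l m : Fin N} (hml : m ≠ l) (gq pq Vq : Fin N → ℕ)
    {g p V d t L H M : ℕ} {e : Entry} (hc : cover2 g p V d t L H (gq m) (pq m) (Vq m) e = true)
    (hLM : L ≤ M) (hMH : M ≤ H) (hpP : 1 ≤ e.2.1) (hwW : 1 ≤ e.2.2.2) (hpm : 1 ≤ pq m)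
    (hdomP : ∀ q, gq q * e.2.1 ≤ e.1 * pq q) (hdomW : ∀ q, gq q * e.2.2.2 ≤ e.2.2.1 * (t * pq q - Vq q))
    (hsum1 : 2 * (∑ q ∈ Finset.univ.erase l, pq q) + d ≤ 3 * M)
    (hsum2 : (∑ q ∈ Finset.univ.erase l, pq q) + 3 * V ≤ 3 * M)
    (hcap : M < 2 * V → ∑ q ∈ Finset.univ.erase l, pq q ≤ (V * V / M + 3 * M) - 4 * V)
    (hcore : 3 ≤ t → V < t * p → (∑ q ∈ Finset.univ.erase l, (t * pq q - Vq q)) + (t * p - V) ≤ t * M + (2 * t * t - 1)) :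
    g + ∑ q ∈ Finset.univ.erase l, gq q ≤ D * M := by
  classical
  have hmS : m ∈ Finset.univ.erase l := Finset.mem_erase.mpr ⟨hml, Finset.mem_univ m⟩
  have split : ∀ f : Fin N → ℕ, ∑ q ∈ Finset.univ.erase l, f q = f m + ∑ q ∈ (Finset.univ.erase l).erase m, f q :=
    fun f => (Finset.add_sum_erase _ _ hmS).symm
  set S2 := (Finset.univ.erase l).erase m with hS2
  have hGP : (∑ q ∈ S2, gq q) * e.2.1 ≤ e.1 * ∑ q ∈ S2, pq q := by
    rw [Finset.sum_mul, Finset.mul_sum]; exact Finset.sum_le_sum fun q _ => hdomP q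
  have hGW : (∑ q ∈ S2, gq q) * e.2.2.2 ≤ e.2.2.1 * ∑ q ∈ S2, (t * pq q - Vq q) := by
    rw [Finset.sum_mul, Finset.mul_sum]; exact Finset.sum_le_sum fun q _ => hdomW q
  rw [split pq] at hsum1 hsum2 hcap
  rw [split gq]
  have key := cover2_sound hc (M := M) (GR := ∑ q ∈ S2, gq q) (R := ∑ q ∈ S2, pq q) (A := ∑ q ∈ S2, (t * pq q - Vq q))
    hLM hMH hpP hwW hpm hGP hGW (by omega) (by omega) (fun h => by have := hcap h; omega)
    (fun h3 hv _ => by have := hcore h3 hv; rw [split (fun q => t * pq q - Vq q)] at this; omega)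
  omega

/-! ## The bucket walk with the two-member fallback (data passed as parameters) -/

section Walk

open TECert (vol us)
open TAStat (e0 cover)

variable (tb tp : ℕ → ℕ) (m2 : ℕ → List (ℕ × ℕ × ℕ)) (m2f : ℕ → Bool) (gain : ℕ → ℕ)

/-- The fallback at bucket `j` for a maximal member (`g, p, V, d`) at budget parameter `t`, orders `[L, H]`: the bucket carries a certified-complete
list `m2 j` of the sorted shapes whose `tm` lies in the bucket (`m2f j`), and every listed shape `m` of volume `≤ V` passes `cover2` as the explicit
second member (gain `gain (vol m)`). [original] -/
def fb (g p V d t L H j : ℕ) (e : Entry) : Bool :=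
  m2f j && (m2 j).all fun m => Nat.blt V (vol m) || cover2 g p V d t L H (gain (vol m)) (us m) (vol m) e

/-- Walk the buckets `j, j+1, …` of a table row (dropped to index `j`) for a maximal member whose own bucket is `j0`: escape once `tiOK V (tb j)`
(no sorted shape of volume `≤ V` reaches the bucket), else `cover` at `t = tp j` or — strictly above `j0` — the fallback `fb`. [original] -/
def walk2 (g p V d L H j0 : ℕ) : List Entry → ℕ → Bool
  | [], _ => true
  | e :: es, j => tiOK V (tb j) ||
      ((cover g p V d (tp j) L H e || (Nat.blt j0 j && fb m2 m2f gain g p V d (tp j) L H j e)) && walk2 g p V d L H j0 es (j + 1))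

/-- Soundness of the fallback: the flag is set and every listed shape of volume `≤ V` passes `cover2`. [bookkeeping] -/
theorem fb_sound {g p V d t L H j : ℕ} {e : Entry} (h : fb m2 m2f gain g p V d t L H j e = true) :
    m2f j = true ∧ ∀ m ∈ m2 j, vol m ≤ V → cover2 g p V d t L H (gain (vol m)) (us m) (vol m) e = true := by
  simp only [fb, Bool.and_eq_true, List.all_eq_true, Bool.or_eq_true, Nat.blt_eq] at h
  obtain ⟨hf, hall⟩ := h
  refine ⟨hf, fun m hm hv => ?_⟩
  rcases hall m hm with hlt | hc
  · omega
  · exact hc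

/-- Soundness of the walk: if no bucket `j + k'`, `k' ≤ k`, escapes, then at bucket `j + k` either `cover` passes at `t = tp (j+k)` or (`j0 < j + k` and)
the fallback passes. [bookkeeping] -/
theorem walk2_sound (g p V d L H j0 : ℕ) : ∀ (es : List Entry) (j : ℕ), walk2 tb tp m2 m2f gain g p V d L H j0 es j = true →
    ∀ k, k < es.length → (∀ k', k' ≤ k → tiOK V (tb (j + k')) = false) →
      cover g p V d (tp (j + k)) L H (es.getD k e0) = true ∨
        (j0 < j + k ∧ fb m2 m2f gain g p V d (tp (j + k)) L H (j + k) (es.getD k e0) = true)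
  | [], j, _, k, hk, _ => by simp at hk
  | e :: es, j, h, k, hk, hsmall => by
    have hunf : walk2 tb tp m2 m2f gain g p V d L H j0 (e :: es) j = (tiOK V (tb j) ||
        ((cover g p V d (tp j) L H e || (Nat.blt j0 j && fb m2 m2f gain g p V d (tp j) L H j e)) &&
          walk2 tb tp m2 m2f gain g p V d L H j0 es (j + 1))) := rfl
    rw [hunf, Bool.or_eq_true, Bool.and_eq_true, Bool.or_eq_true, Bool.and_eq_true, Nat.blt_eq] at h
    rcases h with hstop | ⟨hc, hrest⟩
    · have h0 := hsmall 0 (Nat.zero_le _)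
      simp only [Nat.add_zero] at h0
      rw [h0] at hstop
      exact absurd hstop Bool.false_ne_true
    · cases k with
      | zero => simpa using hc
      | succ k =>
        have hk' : k < es.length := by simpa using hk
        have := walk2_sound g p V d L H j0 es (j + 1) hrest k hk' (fun k' hk'' => by
          have := hsmall (k' + 1) (by omega)
          simpa [Nat.add_right_comm j 1 k', Nat.add_assoc] using this)
        simpa [Nat.add_right_comm j 1 k, Nat.add_assoc] using this

end Walk

end Summit.MatrixMultiplication.MatrixMultiplication.Theorems.TAStat2M
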